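import Summits.KontsevichZagierPeriods.KontsevichZagierPeriods.Theses.HurwitzMicroSectors

/-!
# Strategist gen 3 — crux `NormalFormPrinciple` (stmt-KontsevichZagierPeriods-3869)
# First-lemma signatures for the crux idea `product-island-vz` (lens: transfer)

A dimension-two LAYER of the leaf `stub_boxRigidity` whose rigidity input is a PUBLISHED theorem at a
non-special point: for an integer `q ≥ 9`, Viola–Zudilin 2018 (J. reine angew. Math. 736) prove that
`1, Li₁(1/q), Li₂(1/q), Li₂(1/(1−q))` are `ℚ`-linearly independent; by Landen's identity
`Li₂(1/(1−q)) = −Li₂(1/q) − ½·log²(1 − 1/q)` this is the independence of `1, ℓ, Li₂(1/q), ℓ²` with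
`ℓ = log(q/(q−1)) = Li₁(1/q)`. The "product island" at height `q` is the subgroup of `KZ.FormalRep`
generated by the box-rational representations on `(0,1)²` with integrands (rational multiples of)
  `1`, `1/(q−x)`, `1/(q−y)`, `1/(q−xy)`, `1/((q−x)(q−y))`, `1/((q−x)(q−xy))`, `1/((q−y)(q−xy))`,
  `1/((q−x)(q−y)(q−xy))`,
whose values are `1, ℓ, ℓ, Li₂(1/q), ℓ², (Li₂(1/q) + ℓ²/2)/q, idem, Li₂(1/q)/(q(q−1))` (series
computation, checked to 1e-49 for q = 2,3,5,9,10,12: folder compute/product_island_check.py). The two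
transcendence-FREE instances below generate (over ℚ) all value relations among the eight generators;
the kernel capstone is Conjecture 1 on the island ⟸ VZ(q). Sibling already in the tree: the LINEAR
Padé islands `HermiteRigidity.PadeBoxIslands` (item 15909, proved: integrands `xᵃ/(N − x₁⋯x_w)^m`,
values `1, Li₁(1/N), …, Li_w(1/N)`); the delta here is the PRODUCT period `ℓ²` and the mixed atoms,
i.e. the first island whose value space is a non-linear polynomial algebra in polylogarithms, with the
threshold `q ≥ 9` (VZ) instead of Hata's `q ≥ 12`.
-/

namespace Summit.KontsevichZagierPeriods.KontsevichZagierPeriods.Theses.HurwitzMicroSectors.StrategistGen3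

open Literature.NumberTheory.Transcendental

/-- The open unit box in dimension `n`. -/
def box (n : ℕ) : Set (Fin n → ℝ) := {x | ∀ i, x i ∈ Set.Ioo (0:ℝ) 1}

/-- **MixedAtomSplit** (transcendence-free, every integer `q ≥ 2`):
`2q·∫∫ dxdy/((q−x)(q−xy)) = 2·Li₂(1/q) + log²(q/(q−1)) = 2·∫∫dxdy/(q−xy) + ∫∫dxdy/((q−x)(q−y))`, i.e.
`[(0,1)², 2q/((q−x)(q−xy))] ∼ [(0,1)², 2/(q−xy) + 1/((q−x)(q−y))]`. -/
def MixedAtomSplit : Prop :=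
  ∀ (q : ℕ), 2 ≤ q → ∀ (r r' : KZ.IntegralRep 2), r.domain = box 2 →
    Set.EqOn r.integrand (fun x => 2 * (q : ℝ) / (((q : ℝ) - x 0) * ((q : ℝ) - x 0 * x 1))) (box 2) →
    r'.domain = box 2 →
    Set.EqOn r'.integrand
      (fun x => 2 / ((q : ℝ) - x 0 * x 1) + 1 / (((q : ℝ) - x 0) * ((q : ℝ) - x 1))) (box 2) →
    KZ.Equivalent r r'

/-- **TriplePoleLanden** (transcendence-free, every integer `q ≥ 2`; the value identity is Landen's
functional equation at `z = 1/q` after one Fubini step):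
`q(q−1)·∫∫ dxdy/((q−x)(q−y)(q−xy)) = Li₂(1/q) = ∫∫ dxdy/(q−xy)`, i.e.
`[(0,1)², q(q−1)/((q−x)(q−y)(q−xy))] ∼ [(0,1)², 1/(q−xy)]`. -/
def TriplePoleLanden : Prop :=
  ∀ (q : ℕ), 2 ≤ q → ∀ (r r' : KZ.IntegralRep 2), r.domain = box 2 →
    Set.EqOn r.integrand
      (fun x => (q : ℝ) * ((q : ℝ) - 1) / (((q : ℝ) - x 0) * ((q : ℝ) - x 1) * ((q : ℝ) - x 0 * x 1)))
      (box 2) →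
    r'.domain = box 2 → Set.EqOn r'.integrand (fun x => 1 / ((q : ℝ) - x 0 * x 1)) (box 2) →
    KZ.Equivalent r r'

/-- The eight atoms of the product island at height `q` (as functions on `ℝ²`). -/
noncomputable def atom (q : ℕ) : Fin 8 → ((Fin 2 → ℝ) → ℝ) :=
  ![fun _ => 1,
    fun x => 1 / ((q : ℝ) - x 0),
    fun x => 1 / ((q : ℝ) - x 1),
    fun x => 1 / ((q : ℝ) - x 0 * x 1),
    fun x => 1 / (((q : ℝ) - x 0) * ((q : ℝ) - x 1)),
    fun x => 1 / (((q : ℝ) - x 0) * ((q : ℝ) - x 0 * x 1)),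
    fun x => 1 / (((q : ℝ) - x 1) * ((q : ℝ) - x 0 * x 1)),
    fun x => 1 / (((q : ℝ) - x 0) * ((q : ℝ) - x 1) * ((q : ℝ) - x 0 * x 1))]

/-- Generators of the product island: box representations on `(0,1)²` whose integrand is a rational
multiple of an atom. -/
def islandGens (q : ℕ) : Set KZ.FormalRep :=
  {y | ∃ (c : ℚ) (k : Fin 8) (N : KZ.IntegralRep 2), N.domain = box 2 ∧
      Set.EqOn N.integrand (fun x => (c : ℝ) * atom q k x) (box 2) ∧ y = KZ.of N}

/-- The Viola–Zudilin rigidity input at height `q`, in Landen-normalised form: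
`1, ℓ, Li₂(1/q), ℓ²` are `ℚ`-linearly independent, `ℓ = log(q/(q−1))`, `Li₂(1/q) = Σ_{n≥1} q⁻ⁿ/n²`.
A THEOREM for every integer `q ≥ 9` (Viola–Zudilin 2018, with `Li₂(1/(1−q))` in place of `ℓ²`;
equivalent by Landen). -/
noncomputable def VZ (q : ℕ) : Prop :=
  LinearIndependent ℚ
    ![(1 : ℝ), Real.log ((q : ℝ) / ((q : ℝ) - 1)),
      ∑' n : ℕ, 1 / (((n : ℝ) + 1) ^ 2 * (q : ℝ) ^ (n + 1)),
      Real.log ((q : ℝ) / ((q : ℝ) - 1)) ^ 2]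

/-- **ProductIslandKernel** (the capstone): Conjecture 1 in kernel form on the product island at
height `q`, conditional on the inlined rigidity `VZ q` (a theorem for `q ≥ 9`): every `ℤ`-combination of
island generators with value `0` is a KZ relation. Ingredients: `MixedAtomSplit`, `TriplePoleLanden`,
the swap `x ↔ y` (one linear move), the values of the four normal forms, `VZ q`, integer division
(`MzvKernelInKZ.Negative.mem_relations_of_nsmul_mem`). -/
def ProductIslandKernel : Prop :=
  ∀ (q : ℕ), 2 ≤ q → VZ q → ∀ x ∈ AddSubgroup.closure (islandGens q), KZ.eval x = 0 → x ∈ KZ.relations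

/-- The leaf's exact shape on the island (corollary of the kernel form). -/
def ProductIslandRigidity : Prop :=
  ∀ (q : ℕ), 2 ≤ q → VZ q → ∀ (r r' : KZ.IntegralRep 2),
    KZ.of r ∈ AddSubgroup.closure (islandGens q) → KZ.of r' ∈ AddSubgroup.closure (islandGens q) →
    r.value = r'.value → KZ.Equivalent r r'

/-- Sanity: the corollary follows from the kernel form by soundness-free algebra
(`of r − of r'` lies in the closure and has `eval = value r − value r' = 0`). -/
theorem productIslandRigidity_of_kernel (h : ProductIslandKernel) : ProductIslandRigidity := by
  intro q hq hVZ r r' hr hr' hv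
  have hmem : KZ.of r - KZ.of r' ∈ AddSubgroup.closure (islandGens q) :=
    AddSubgroup.sub_mem _ hr hr'
  have heval : KZ.eval (KZ.of r - KZ.of r') = 0 := by
    simp [KZ.eval, KZ.of, hv]
  exact h q hq hVZ _ hmem heval

end Summit.KontsevichZagierPeriods.KontsevichZagierPeriods.Theses.HurwitzMicroSectors.StrategistGen3
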